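import Literature.Probability.Percolation.CollarWindowLandingBridge
import HarnessLib

/-!
# Landing legs read in window coordinates

Topic `Probability/Percolation`.  Support file (proofs, no named fact) for the named fact
`SchrammSmirnov2011_thm_1_7` (the landing count of the proof of Prop. 4.1, Ann. Probab. 39 (2011),
§4): a LANDING LEG of the collar exploration — a lattice edge `{y, n}` with `y ∈ 𝒪` and a wet face —
which a lattice symmetry `ψ` carries onto the leg `{(x,0), (x,-1)}` of a clean straight window of
the transported datum, is a landing at abscissa `x` of that window in the sense of
`CollarDatum.LandingAt`, for the transported configuration (`landingAt_map_of_leg`); hence two such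
legs at abscissae `j+1 ≤ x < x' < j+m` put the configuration in the pulled-back bad patterns
`patternOneAt ∪ patternTwoAt` (`mem_patternAt_of_two_legs`), whose probability is bounded by
`CollarDatum.real_patternAt_le_two_factor`.

## References

* O. Schramm, S. Smirnov, *On the scaling limits of planar percolation*, Ann. Probab. 39 (2011)
  1768–1814, arXiv:1101.5820, §4, proof of Prop. 4.1. [SchrammSmirnov2011]
-/

noncomputable section

open Relation
open Literature.Probability.LatticeModels

namespace Literature.Probability.Percolation

namespace Seeded

namespace CollarDatum

variable {𝒞 : CollarDatum} {ψ : LatticeSym} {j : ℤ} {m R₁ : ℕ}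

/-- **A landing leg in window coordinates is a landing.** [cite: SchrammSmirnov2011, §4, proof of Prop. 4.1 (the legs of the interfaces on β')] -/
theorem landingAt_map_of_leg (hW : (𝒞.map ψ).CleanWindow j m R₁) {ω : BondConfig (Site 2)} {x : ℤ}
    (hx : j - R₁ ≤ x) (hx' : x ≤ j + m + R₁) {y n : Site 2} (hy : ψ.σ y = ![x, 0]) (hn : ψ.σ n = ![x, -1])
    (hO : OReach 𝒞.seeds (examined 𝒞.seeds ω) ω y) {f : Site 2} (hf : IsFaceOf f s(y, n))
    (hD : DReach 𝒞.seeds (examined 𝒞.seeds ω) ω f) :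
    (𝒞.map ψ).LandingAt (ψ.relabel ω) x := by
  have hO' : OReach (𝒞.map ψ).seeds (examined (𝒞.map ψ).seeds (ψ.relabel ω)) (ψ.relabel ω) ![x, 0] := by
    rw [map_seeds, ← hy]
    exact (ψ.oReach_examined_map_iff 𝒞.seeds ω y).2 hO
  have hD' : DReach (𝒞.map ψ).seeds (examined (𝒞.map ψ).seeds (ψ.relabel ω)) (ψ.relabel ω) (ψ.σF f) := by
    rw [map_seeds]
    exact (ψ.dReach_examined_map_iff 𝒞.seeds ω f).2 hD
  -- the transported face is one of the two faces of the leg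
  have he : s(y, n) ∈ (zdGraph 2).edgeSet := by
    rw [← ψ.mem_edgeSet_iff]
    change s(ψ.σ y, ψ.σ n) ∈ (zdGraph 2).edgeSet
    rw [hy, hn, SimpleGraph.mem_edgeSet, zdGraph_adj_iff]
    exact ⟨1, Or.inr (by funext k; fin_cases k <;> simp)⟩
  have hf' : IsFaceOf (ψ.σF f) s((![x, -1] : Site 2), ![x, -1] + Pi.single 1 1) := by
    have h1 := (ψ.isFaceOf_map_iff he f).2 hf
    have h2 : ψ.edgeEquiv s(y, n) = s((![x, -1] : Site 2), ![x, -1] + Pi.single 1 1) := by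
      change s(ψ.σ y, ψ.σ n) = _
      rw [hy, hn, Sym2.eq_swap]
      congr 1; funext k; fin_cases k <;> simp
    rwa [h2] at h1
  rcases (isFaceOf_single_iff (i := 1) (j := 0) (by decide)).1 hf' with h | h
  · have e0 : (![x, -1] : Site 2) - Pi.single 0 1 = ![x - 1, -1] := by funext k; fin_cases k <;> simp
    rw [h, e0] at hD'
    exact hW.landingAt_of_moat hx hx' hO' (Or.inr hD')
  · rw [h] at hD'
    exact hW.landingAt_of_moat hx hx' hO' (Or.inl hD')

/-- **Two landing legs in a window give a bad pattern** (pulled back to the original lattice).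
[cite: SchrammSmirnov2011, §4, proof of Prop. 4.1 ("three crossings … land on the arc")] -/
theorem mem_patternAt_of_two_legs (hW : (𝒞.map ψ).CleanWindow j m R₁) {ω : BondConfig (Site 2)}
    {x x' : ℤ} (hjx : j + 1 ≤ x) (hxx' : x < x') (hx'm : x' < j + m)
    {y n : Site 2} (hy : ψ.σ y = ![x, 0]) (hn : ψ.σ n = ![x, -1])
    (hO : OReach 𝒞.seeds (examined 𝒞.seeds ω) ω y) {f : Site 2} (hf : IsFaceOf f s(y, n))
    (hD : DReach 𝒞.seeds (examined 𝒞.seeds ω) ω f)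
    {y' n' : Site 2} (hy' : ψ.σ y' = ![x', 0]) (hn' : ψ.σ n' = ![x', -1])
    (hO' : OReach 𝒞.seeds (examined 𝒞.seeds ω) ω y') {f' : Site 2} (hf' : IsFaceOf f' s(y', n'))
    (hD' : DReach 𝒞.seeds (examined 𝒞.seeds ω) ω f') :
    ω ∈ 𝒞.patternOneAt ψ j m ∪ 𝒞.patternTwoAt ψ j m := by
  have h1 := landingAt_map_of_leg hW (by omega) (by omega) hy hn hO hf hD
  have h2 := landingAt_map_of_leg hW (by omega) (by omega) hy' hn' hO' hf' hD'
  rw [patternOneAt, patternTwoAt, ← Set.preimage_union, Set.mem_preimage]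
  exact pattern_of_two_landings hjx hxx' hx'm h1 h2

end CollarDatum

end Seeded

end Literature.Probability.Percolation

end
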